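import Literature.NumberTheory.EllipticCurves.HeathBrown1994.CongruentTwoSelmerOddGraphFamilies
import Literature.NumberTheory.EllipticCurves.FaulknerJames2007.RhoIndexEvenPartitionBound
import Literature.NumberTheory.EllipticCurves.TianYuanZhang2017.ScriptLOddOfRhoZero
import Literature.NumberTheory.EllipticCurves.TianYuanZhang2017.GenusFieldFamily
import Literature.NumberTheory.EllipticCurves.LiLiuTian2024.CongruentNumberRedeiFamilies
import HarnessLib

/-!
# Tian's class-`7` family `n = p₀p₁⋯p_k` (`p₀ ≡ 7`, `pᵢ ≡ 1 (mod 8)`, odd graph): condition (1.1),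
# `s(n) = 1`, `ρ(n) = 0` and the odd genus sum of Tian–Yuan–Zhang — as UNIFORM-in-`k` kernel theorems

HONEST FRAMING (cell `b2b-bsdres`, sub-lane «bsd-p2», literature seat `p2-lit-1`, charter "Tian 2014 /
Tian–Yuan–Zhang 2017 / Cai–Li–Zhai AS PRINTED"): this file PROVES theorems — NO definition, NO named fact
(`def … : Prop`), NO `sorry`; every class-group statement is MODULO the displayed Rédei–Reichardt fact
`redeiReichardt_fourTwoCard_classGroup` (`hR`, Li–Ma 2008 Thm. 0.4, p319707) taken as an explicit
hypothesis, and §5 displays Tian–Yuan–Zhang 2017 Thm. 1.2 (`h12`) resp. Tian 2014 Thm. 1.3 (`h13`) the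
same way.  What is proved is `𝔽₂`-linear algebra on three printed matrices (Monsky's `M`, Rédei's
`RM(D)`, Faulkner–James' `L(G(−n))`) and bookkeeping on Tian–Yuan–Zhang's genus sums.  It is NOT a
`2`-part-of-BSD statement: the door that turns these inputs into `BSD(E_n, 2)` lives under
`Summits/…/Rank1Residual/P2/` (one-writer rule) and is not imported here.  Nothing booked; no mark moved.

## The family (Tian, Camb. J. Math. 2 (2014), Thm. 1.3 and Lemma 5.1)

Tian 2014, Thm. 1.3 [arXiv:1210.8231 p. 2 L5–L15]: "Let `k ≥ 0` be an integer and `n = p₀p₁⋯p_k` a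
product of distinct odd primes with `pᵢ ≡ 1 mod 8` for `1 ≤ i ≤ k`. Assume that the ideal class group `𝒜`
of the field `K = ℚ(√−2n)` satisfies the condition: (1.1) `dim_{𝔽₂}(𝒜[4]/𝒜[2]) = 0` if `n ≡ ±3 mod 8`,
`1` otherwise. Let `m = n` or `2n` such that `m ≡ 5, 6`, or `7 mod 8` … Then `rank_ℤ E^{(m)}(ℚ) = 1 =
ord_{s=1} L(E^{(m)}, s)`. Moreover, the Shafarevich–Tate group of `E^{(m)}` is finite and has odd
cardinality."  Lemma 5.1 [p. 28 L2–L14]: with `G` "the graph whose vertices set `V` consists of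
`p₀, ⋯, p_k` and whose edges are those `pᵢpⱼ`, `i ≠ j`, with `(pᵢ/pⱼ) = −1`", "(1.1) is equivalent to any
one of: (1) there does not exist a proper even partition of vertices …; (2) the graph `G` has exactly odd
number of spanning subtrees" (proof p. 28 L15–L35, citing "[7] Lemma 2.2" = Feng 1996 for (1) ⟺ (2)).
Lemma 5.3 [p. 28 L71 – p. 29 L32]: under (1.1), `dim_{𝔽₂} S^{(φ)} = 1` and `dim_{𝔽₂} S^{(ψ)} = 2` ("`S(ψ)`
consists of `±1, ±n`", p. 29 L26–L27), "and moreover (5.1) `dim_{𝔽₂} S^{(2)}(E^{(m)}/ℚ)/E^{(m)}[2] = 1`".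

THIS FILE treats the member `m = n ≡ 7 (mod 8)`, i.e. `p₀ ≡ 7 (mod 8)` ("class 7"), with the graph
condition in Feng's KERNEL FORM used by the tree (`HeathBrown1994/CongruentTwoSelmerOddGraphFamilies.lean`):
`hG : ∀ v, A v = 0 → v = 0 ∨ v = (1,…,1)`, `A = legendreMatrix p` = the Laplacian of `G` over `𝔽₂` (Feng's
Lemma 2.2: "`G` odd iff `rank A = t − 1`"; `A` is symmetric here by reciprocity since all `pᵢ ≡ 1 (mod 4)`
but `p₀`).  Binders throughout: `p : Fin (k+1) → ℕ` injective primes, `p 0 % 8 = 7`,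
`p i % 8 = 1 (i ≠ 0)`, `hG`; `n = ∏ pᵢ`.

## What is PROVED (uniformly in `k`; `k = 0` is the prime family `q ≡ 7 (mod 8)`)

* §1 `monskyMatrixOdd_mulVec_eq_zero_iff_caseSeven`, `card_ker_monskyMatrixOdd_caseSeven`: Monsky's matrix
  `M = (A + D₂, D₂; D₂, A + D₋₂)` (Heath-Brown 1994, appendix) has `D₂ = 0`, `D₋₂ = E₁₁` on the family and
  kernel EXACTLY `{0, (1;0)}`: `#ker M = 2`, `s(n) = 2(k+1) − rank M = 1` (`monskySelmerRankOdd_caseSeven`).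
  This is (5.1) in Monsky's currency — the input `hker` of the sub-lane's door D-CN-6.
* §2 `fjLaplacianNeg_mulVec_eq_zero_iff_caseSeven`, `card_ker_fjLaplacianNeg_caseSeven`: Faulkner–James'
  Laplacian `L(G(−n))` has null space `{x : (x_{p₀},…,x_{p_k}) ∈ {0, 1}}` of size `4` — only the trivial
  even partitions, `S′_n = {±1, ±n}` (Lemma 5.3's "`S(ψ)` consists of `±1, ±n`") — hence, by the tree's
  PROVED bound `4·[E_n(ℚ) : φ_n(A_n(ℚ)) + E_n[2]] ≤ #NS` (`FaulknerJames2007.rhoIndex_eq_one_of_card_ker`),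
  Tian–Yuan–Zhang's `ρ(n) = 0`: `rhoIndex_eq_one_caseSeven` (extends `rhoIndex_eq_one_of_prime`, the case
  `k = 0`, to every `k`) — the input `hρ` of door D-CN-6.
* §3 `condition11_caseSeven` (mod `hR`): Lemma 5.1, direction "(1) ⟹ (1.1)", as a theorem — `RM(−8n)` on
  `(2; p₀,…,p_k)` is `(0 0; 0 A)` (the row and the column of the prime `2` vanish: `D₂ = 8`,
  `(8/pₐ) = +1` and `D_b ≡ 1 (mod 8)`), its kernel has `4 = 2^{1+1}` elements, so `#(2𝒜 ∩ 𝒜[2]) = 2`, i.e.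
  `Tian2014.Condition11 n K` for every quadratic `K ∋ √−2n`.
* §4 `odd_genusSum₁_caseSeven` (mod `hR`): the first genus sum `Σ₁(n)` of Tian–Yuan–Zhang Thm. 1.2 over the
  fields `K_d = GenusField d` is ODD — by the mechanism of their proof of Cor. 1.4 [arXiv:1411.4728 chunk
  p0003 L35–L50: "By Rédei, `g(d)` is even in any of the following cases: … `d = p₁⋯p_k ≡ 1 (mod 8)`,
  `pᵢ ≡ 1 (mod 4)`, `k > 0` … It follows that … `Σ ∏ g(dᵢ) ≡ g(n) (mod 2)`"]: every decomposition other than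
  `{n}` has a factor `d > 1` prime to `p₀` (`exists_mem_not_dvd_of_mem_decompositions`), such `d ∣ p₁⋯p_k`
  has `g(d)` even (`even_genusClassNumber_of_dvd_caseSeven`: in `RM(−4d)` the row and column of `2`
  vanish), and `g(n)` is odd (`odd_genusClassNumber_caseSeven`: `RM(−n) = A`, `rank A = k`).  The input
  `hgen` of door D-CN-6.  A Literature-level Rédei lemma on an arbitrary index type
  (`odd_genusClassNumber_iff_card_ker_of_redeiReichardt`) is included for this purpose.
* §5 consequences: `rankOneDatum_caseSeven` (mod `h12`, `hR`): `ord_{s=1} L(E_n, s) = 1` and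
  `L′(E_n, 1) = 2^{2k−1}·𝓛²·Ω(E_n)·Reg(E_n)` with `𝓛` odd — Tian–Yuan–Zhang's datum at `ρ = 0` on the whole
  family; `thm13_caseSeven`, `card_primaryComponent_sha_two_caseSeven` (mod `h13`, `hR`): Tian's Thm. 1.3
  applied with (1.1) DISCHARGED by §3 — `rank = r_an = 1`, `Ш(E_n)` finite odd, `Ш(E_n)[2^∞] = 0`.
* §6 `card_ker_monskyTable_caseSeven`: §1 in the literal table shape of the door's `hker`.

With §1, §2, §4 the sub-lane's nothing-displayed door `bsdp_two_congruentNumberCurve_of_genus'`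
(`P2/CongruentNumberPairsAtTwoPrimeSevenModEight.lean` §0; inputs `h12`, `hGZK`, `hM`, the tuple `p`, `hker`,
`hρ`, `hgen`) yields `BSD(E_n, 2)` for EVERY member of the family and every `k` as one theorem — its
assembly is the typer's (one-writer rule for `P2/`), not done here.

AT `p = 2`: every statement here is `2`-adic descent data for `E_n : y² = x³ − n²x` (additive reduction at
`2`); no prime is excluded by any hypothesis.  NOT treated: Tian's classes `m = n ≡ 5 (mod 8)` (`p₀ ≡ 5`;
the Faulkner–James bound of §2 is printed for `n ≡ ±1 (mod 8)` only) and `m = 2n ≡ 6 (mod 8)` (Monsky's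
even matrix) — TODO(general form): the §1/§3 computations go through verbatim there, §2 needs the
`n ≡ ±3 (mod 8)` graph `G(+n)` of Faulkner–James Thm. 1.2 (1).

## References

* [Tian2014] Y. Tian, *Congruent numbers and Heegner points*, Camb. J. Math. 2 (2014) 117–161 =
  arXiv:1210.8231: Thm. 1.3 (p. 2 L5–L15), Rem. 1.4 (p. 2 L16–L22), Lemma 5.1 (p. 28 L2–L35), Thm. 5.2
  (p. 28 L40–L67), Lemma 5.3 and (5.1) (p. 28 L71 – p. 29 L32).
* [TianYuanZhang2017] Y. Tian, X. Yuan, S.-W. Zhang, *Genus periods, genus points and congruent number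
  problem*, Asian J. Math. 21 (2017) 721–774 = arXiv:1411.4728: §1 (`g(d)`, `ρ(n)`; chunk p0002 L76–L110),
  Thm. 1.2 (p0002 L112–L127), Cor. 1.4 and its proof (p0003 L13–L50).
* [HeathBrown1994SelmerCongruentII] D. R. Heath-Brown, appendix by P. Monsky, Invent. Math. 118 (1994),
  typescript p. 39 L10–L33 (the matrix `M`, `s(D) = 2n − rank M`).
* [FaulknerJames2007] B. Faulkner, K. James, Ramanujan J. 14 (2007) 107–129, Def. 1.5, Thm. 1.2 (2),
  Lemma 5.1, §5.
* [Feng1996NonCongruent] K. Feng, Acta Arith. 75 (1996) 71–83, §2 Lemma 2.2 (odd graphs ⟺ `rank = t − 1`).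
* [LiMa2008] Y. Li, L. Ma, Acta Arith. 134 (2008), Lemma 0.1, Def. 0.2, Thm. 0.4 (Rédei–Reichardt).
* [IrelandRosen1990] K. Ireland, M. Rosen, GTM 84, Ch. 5 §1 Prop. 5.1.2, §2 Prop. 5.2.2 and Thm. 2.
* [Cox2013] D. A. Cox, *Primes of the form x² + ny²*, 2nd ed., §5.B (the symbol `(D/2)`).
* [HardyWright2008] G. H. Hardy, E. M. Wright, 6th ed., §17.8.
* Tree: `HeathBrown1994/CongruentTwoSelmerOddGraphFamilies.lean` (p2-monsky-lit; the `s = 0` mirror of §1,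
  whose §1–§2 lemmas are reused), `FaulknerJames2007/RhoIndexEvenPartitionBound.lean`,
  `TianYuanZhang2017/{GenusPeriodsParity, GenusFieldFamily, ScriptLOddOfRhoZero}.lean`,
  `QuadraticFields/RedeiMatrixFourRank.lean`, `LiLiuTian2024/CongruentNumberRedeiFamilies.lean`;
  HOME/p2/LIT-STATUS.md §T1 (rows T1-T2, T1-T5, T1-T7, T1-M15, T1-M28/M29); unit `b2b-bsdres-p2-lit-1` GEN 7.
-/

noncomputable section

open scoped Classical

open Matrix Finset Literature.NumberTheory.EllipticCurves
  Literature.NumberTheory.EllipticCurves.HeathBrown1994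
  Literature.NumberTheory.EllipticCurves.HeathBrown1994.Families
  Literature.NumberTheory.EllipticCurves.TianYuanZhang2017
  Literature.NumberTheory.EllipticCurves.FaulknerJames2007
  Literature.NumberTheory.EllipticCurves.LiLiuTian2024.RedeiFamilies
  Literature.NumberTheory.QuadraticFields.RedeiReichardt

set_option autoImplicit false

namespace Literature.NumberTheory.EllipticCurves.Tian2014

variable {k : ℕ} (p : Fin (k + 1) → ℕ)

/-! ## §0 The family: residues, parity, the product -/

/-- In the class-`7` family every `pᵢ` is odd. [cite: Tian2014, Thm. 1.3 (arXiv p. 2, L5–L7: distinct odd primes)] -/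
theorem odd_of_caseSeven (h7 : p 0 % 8 = 7) (h1 : ∀ i, i ≠ 0 → p i % 8 = 1) (i : Fin (k + 1)) :
    Odd (p i) := by
  rcases eq_or_ne i 0 with rfl | hi
  · exact Nat.odd_iff.mpr (by omega)
  · have := h1 i hi; exact Nat.odd_iff.mpr (by omega)

/-- In the class-`7` family `pᵢ ≡ 1 (mod 4)` for `i ≠ 0`. [cite: Tian2014, Thm. 1.3 (arXiv p. 2, L5–L7)] -/
theorem mod_four_of_caseSeven (h1 : ∀ i, i ≠ 0 → p i % 8 = 1) (i : Fin (k + 1)) (hi : i ≠ 0) :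
    p i % 4 = 1 := by
  have := h1 i hi; omega

/-- `n = p₀p₁⋯p_k ≡ 7 (mod 8)` in the class-`7` family (so `m = n ≡ 7` is Tian's case `m ≡ 7 (mod 8)`).
[cite: Tian2014, Thm. 1.3 (arXiv p. 2, L11–L12: m ≡ 5, 6, 7 mod 8)] -/
theorem prod_mod_eight_caseSeven (h7 : p 0 % 8 = 7) (h1 : ∀ i, i ≠ 0 → p i % 8 = 1) :
    (∏ i, p i) % 8 = 7 := by
  rw [Fin.prod_univ_succ, Nat.mul_mod, Finset.prod_nat_mod]
  have h : ∀ i : Fin k, p i.succ % 8 = 1 := fun i => h1 _ (Fin.succ_ne_zero i)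
  simp only [h, Finset.prod_const_one, Nat.one_mod, h7]

/-- `n = p₀p₁⋯p_k ≡ 3 (mod 4)` in the class-`7` family (`disc ℚ(√−n) = −n`).
[cite: LiMa2008, Lemma 0.1 (p. 279: D = −n for −n ≡ 1 mod 4)] -/
theorem prod_mod_four_caseSeven (h7 : p 0 % 8 = 7) (h1 : ∀ i, i ≠ 0 → p i % 8 = 1) :
    (∏ i, p i) % 4 = 3 := by
  have := prod_mod_eight_caseSeven p h7 h1; omega

/-! ## §1 Monsky's matrix on the family: the kernel is `{0, (1;0)}`, i.e. `s(n) = 1` (Tian's (5.1)) -/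

/-- `D₂ = 0` on the class-`7` family: `(2/p) = +1` for `p ≡ ±1 (mod 8)`.
[cite: IrelandRosen1990, Ch. 5 §2 Prop. 5.2.2] -/
theorem legendreDiagonal_two_caseSeven (h7 : p 0 % 8 = 7) (h1 : ∀ i, i ≠ 0 → p i % 8 = 1) :
    legendreDiagonal p 2 = 0 := by
  unfold legendreDiagonal
  rw [← Matrix.diagonal_zero]
  congr 1
  ext j
  rcases eq_or_ne j 0 with rfl | hj
  · exact addLegendreSym_of_eq_one (jacobiSym_two_eq_one (Or.inr h7))
  · exact addLegendreSym_of_eq_one (jacobiSym_two_eq_one (Or.inl (h1 j hj)))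

/-- `D₋₂ = E₁₁` on the class-`7` family: `(−2/p₀) = −1` (`p₀ ≡ 7 (mod 8)`), `(−2/pᵢ) = +1` (`pᵢ ≡ 1`).
[cite: IrelandRosen1990, Ch. 5 §2 Prop. 5.2.2] -/
theorem legendreDiagonal_neg_two_caseSeven (h7 : p 0 % 8 = 7) (h1 : ∀ i, i ≠ 0 → p i % 8 = 1) :
    legendreDiagonal p (-2) =
      Matrix.diagonal fun j : Fin (k + 1) => if j = 0 then (1 : ZMod 2) else 0 := by
  unfold legendreDiagonal
  congr 1
  ext j
  rcases eq_or_ne j 0 with rfl | hj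
  · rw [if_pos rfl]; exact addLegendreSym_of_eq_neg_one (jacobiSym_neg_two_eq_neg_one (Or.inr h7))
  · rw [if_neg hj]; exact addLegendreSym_of_eq_one (jacobiSym_neg_two_eq_one (Or.inl (h1 j hj)))

/-- **The kernel of Monsky's matrix on Tian's class-`7` family** (`n = p₀⋯p_k`, `p₀ ≡ 7`, `pᵢ ≡ 1 (mod 8)`,
`G(n)` odd in Feng's kernel form `hG`): `M(x; y) = 0 ⟺ (x; y) ∈ {(0; 0), (1; 0)}`.  Mechanism: `D₂ = 0`,
`D₋₂ = E₁₁`, so `M = (A 0; 0 A + E₁₁)`; the bottom block forces `y₀ = 0` (column sums of the symmetric `A`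
vanish) and `Ay = 0`, whence `y = 0`; the top block is `Ax = 0`.  This is Tian's
`dim_{𝔽₂} Sel₂(E^{(n)})/E^{(n)}[2] = 1` ((5.1), from Lemma 5.3) in the currency of Monsky's matrix
(`s(n) = 2(k+1) − rank M = 1`), uniformly in `k`.
[cite: Tian2014, Lemma 5.3 and (5.1) (arXiv p. 28 L71 – p. 29 L31)]
[cite: HeathBrown1994SelmerCongruentII, Appendix (Monsky), typescript p. 39 L27–L33 (the matrix; evaluation ours)] -/
theorem monskyMatrixOdd_mulVec_eq_zero_iff_caseSeven (h7 : p 0 % 8 = 7) (h1 : ∀ i, i ≠ 0 → p i % 8 = 1)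
    (hG : ∀ v, legendreMatrix p *ᵥ v = 0 → v = 0 ∨ v = fun _ => 1)
    (z : Fin (k + 1) ⊕ Fin (k + 1) → ZMod 2) :
    monskyMatrixOdd p *ᵥ z = 0 ↔ z = 0 ∨ z = Sum.elim (fun _ => 1) 0 := by
  have hodd := odd_of_caseSeven p h7 h1
  have hsymm := legendreMatrix_transpose_eq p hodd (mod_four_of_caseSeven p h1)
  set E : Matrix (Fin (k + 1)) (Fin (k + 1)) (ZMod 2) :=
    Matrix.diagonal fun j : Fin (k + 1) => if j = 0 then (1 : ZMod 2) else 0 with hE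
  have hD2 : legendreDiagonal p 2 = 0 := legendreDiagonal_two_caseSeven p h7 h1
  have hDm2 : legendreDiagonal p (-2) = E := legendreDiagonal_neg_two_caseSeven p h7 h1
  constructor
  · intro hz
    obtain ⟨x, y, rfl⟩ : ∃ x y, z = Sum.elim x y :=
      ⟨z ∘ Sum.inl, z ∘ Sum.inr, (Sum.elim_comp_inl_inr z).symm⟩
    rw [monskyMatrixOdd, hD2, hDm2, add_zero, Matrix.fromBlocks_mulVec] at hz
    simp only [Sum.elim_comp_inl, Sum.elim_comp_inr, Matrix.zero_mulVec, add_zero, zero_add] at hz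
    have htop : legendreMatrix p *ᵥ x = 0 := by
      funext i; have := congr_fun hz (Sum.inl i); simpa only [Sum.elim_inl, Pi.zero_apply] using this
    have hbot : legendreMatrix p *ᵥ y + E *ᵥ y = 0 := by
      funext i; have := congr_fun hz (Sum.inr i)
      simpa only [Sum.elim_inr, Pi.zero_apply, Matrix.add_mulVec] using this
    have hbot' : legendreMatrix p *ᵥ y = E *ᵥ y := by
      rw [eq_neg_of_add_eq_zero_left hbot, neg_eq_self_pi]
    obtain ⟨hy0, hAy⟩ := mulVec_eq_zero_of_eq_indicator p hsymm hbot'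
    have hy : y = 0 := eq_zero_of_mulVec_eq_zero p hG hAy hy0
    subst hy
    rcases hG x htop with hx | hx
    · left; subst hx; funext i; cases i <;> rfl
    · right; subst hx; funext i; cases i <;> rfl
  · rintro (rfl | rfl)
    · exact Matrix.mulVec_zero _
    · rw [monskyMatrixOdd, hD2, hDm2, add_zero, Matrix.fromBlocks_mulVec]
      simp only [Sum.elim_comp_inl, Sum.elim_comp_inr, Matrix.zero_mulVec, Matrix.mulVec_zero, add_zero,
        legendreMatrix_mulVec_one]
      funext i; cases i <;> rfl

/-- **`#ker M = 2` (`s(n) = 1`) on Tian's class-`7` family, uniformly in `k`** — the Monsky kernel count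
`hker` of the sub-lane's door D-CN-6 (`#{v : M v = 0} = 2`), with NO per-`n` certificate.  (For the
door's table form take `L i j := addLegendreSym (p j) (p i)`, `d2 i := addLegendreSym 2 (p i)`,
`dm2 i := addLegendreSym (−2) (p i)`: its block matrix is `monskyMatrixOdd p` by `rfl`.)
[cite: Tian2014, Lemma 5.3 and (5.1) (arXiv p. 28 L71 – p. 29 L31)]
[cite: HeathBrown1994SelmerCongruentII, Appendix (Monsky), typescript p. 39 L27–L33] -/
theorem card_ker_monskyMatrixOdd_caseSeven (h7 : p 0 % 8 = 7) (h1 : ∀ i, i ≠ 0 → p i % 8 = 1)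
    (hG : ∀ v, legendreMatrix p *ᵥ v = 0 → v = 0 ∨ v = fun _ => 1) :
    Fintype.card {z : Fin (k + 1) ⊕ Fin (k + 1) → ZMod 2 // monskyMatrixOdd p *ᵥ z = 0} = 2 := by
  rw [Fintype.card_of_subtype ({0, Sum.elim (fun _ => 1) 0} : Finset (Fin (k + 1) ⊕ Fin (k + 1) → ZMod 2))
    (fun z => by
      rw [Finset.mem_insert, Finset.mem_singleton]
      exact (monskyMatrixOdd_mulVec_eq_zero_iff_caseSeven p h7 h1 hG z).symm)]
  refine Finset.card_pair fun h => ?_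
  have := congr_fun h (Sum.inl 0)
  exact zero_ne_one this

/-- `s(n) = 2(k+1) − rank M = 1` on the family (Monsky's printed reading of the kernel count).
[cite: HeathBrown1994SelmerCongruentII, Appendix (Monsky), typescript p. 39 L33 (s(D) = 2n − rank M)]
[cite: Tian2014, (5.1) (arXiv p. 29)] -/
theorem monskySelmerRankOdd_caseSeven (h7 : p 0 % 8 = 7) (h1 : ∀ i, i ≠ 0 → p i % 8 = 1)
    (hG : ∀ v, legendreMatrix p *ᵥ v = 0 → v = 0 ∨ v = fun _ => 1) :
    monskySelmerRankOdd p = 1 := by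
  have hcard := natCard_ker_mulVecLin_eq (monskyMatrixOdd p)
  have h2 : Nat.card (LinearMap.ker (monskyMatrixOdd p).mulVecLin) = 2 := by
    rw [Nat.card_congr (Equiv.subtypeEquivRight (q := fun v => monskyMatrixOdd p *ᵥ v = 0)
      fun v => by rw [LinearMap.mem_ker, Matrix.mulVecLin_apply]), Nat.card_eq_fintype_card]
    exact card_ker_monskyMatrixOdd_caseSeven p h7 h1 hG
  rw [h2, Fintype.card_sum, Fintype.card_fin] at hcard
  have hle : (monskyMatrixOdd p).rank ≤ k + 1 + (k + 1) := by
    have := Matrix.rank_le_card_width (monskyMatrixOdd p)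
    simpa [Fintype.card_sum, Fintype.card_fin] using this
  unfold monskySelmerRankOdd
  have key : k + 1 + (k + 1) - (monskyMatrixOdd p).rank = 1 := by
    by_contra hne
    rcases Nat.lt_or_gt_of_ne hne with hlt | hgt
    · have h0 : k + 1 + (k + 1) - (monskyMatrixOdd p).rank = 0 := by omega
      rw [h0, pow_zero] at hcard; omega
    · have : (2 : ℕ) ^ 2 ≤ 2 ^ (k + 1 + (k + 1) - (monskyMatrixOdd p).rank) :=
        Nat.pow_le_pow_right two_pos hgt
      omega
  omega

/-! ## §2 Faulkner–James' Laplacian `L(G(−n))` on the family: null space of size `4`, hence `ρ(n) = 0` -/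

/-- **Euler's bit = Monsky's additive symbol.** For an odd prime `r ∤ a`, the computable Kronecker bit of
Rédei's matrix / Faulkner–James' graph agrees with the additive Legendre symbol of Monsky's matrix:
`kroneckerBit a r = addLegendreSym a r` (both are `[(a/r) = −1]`).
[cite: IrelandRosen1990, Ch. 5 §1 Prop. 5.1.2 (Euler's criterion)] -/
theorem kroneckerBit_eq_addLegendreSym {a : ℤ} {r : ℕ} (hr : r.Prime) (hr2 : r ≠ 2)
    (ha : (a : ZMod r) ≠ 0) : kroneckerBit a r = addLegendreSym a r := by
  haveI : Fact r.Prime := ⟨hr⟩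
  have hpm : jacobiSym a r = 1 ∨ jacobiSym a r = -1 := by
    rw [← jacobiSym.legendreSym.to_jacobiSym]; exact legendreSym.eq_one_or_neg_one r ha
  rcases hpm with h | h
  · rw [addLegendreSym_of_eq_one h, (kroneckerBit_eq_zero_iff_jacobiSym hr hr2 ha).mpr h]
  · rw [addLegendreSym_of_eq_neg_one h, (kroneckerBit_eq_one_iff_jacobiSym hr hr2 ha).mpr h]

/-- **Four vectors.** In `𝔽₂^{t+2}` exactly four vectors have tail `(x₁, …, x_{t+1}) ∈ {0, (1,…,1)}`
(free first coordinate).  The common count behind §2 and §3. [cite: FaulknerJames2007, Lemma 5.1 (number of even partitions = 2^{s−R})] -/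
theorem card_tail_eq_zero_or_one (t : ℕ) :
    Fintype.card {x : Fin (t + 1 + 1) → ZMod 2 // x ∘ Fin.succ = 0 ∨ x ∘ Fin.succ = fun _ => 1} = 4 := by
  have h01 : ∀ c : ZMod 2, c = 0 ∨ c = 1 := by decide
  rw [Fintype.card_of_subtype
    ({Fin.cons 0 0, Fin.cons 0 (fun _ => 1), Fin.cons 1 0, Fin.cons 1 (fun _ => 1)} :
      Finset (Fin (t + 1 + 1) → ZMod 2)) (fun x => ?_)]
  · rw [Finset.card_insert_of_notMem, Finset.card_insert_of_notMem, Finset.card_pair]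
    · intro h
      have := congr_fun h (Fin.succ 0)
      simp at this
    · simp only [Finset.mem_insert, Finset.mem_singleton, not_or]
      refine ⟨fun h => ?_, fun h => ?_⟩
      · have := congr_fun h 0; simp at this
      · have := congr_fun h 0; simp at this
    · simp only [Finset.mem_insert, Finset.mem_singleton, not_or]
      refine ⟨fun h => ?_, fun h => ?_, fun h => ?_⟩
      · have := congr_fun h (Fin.succ 0); simp at this
      · have := congr_fun h 0; simp at this
      · have := congr_fun h 0; simp at this
  · simp only [Finset.mem_insert, Finset.mem_singleton]
    constructor
    · rintro (rfl | rfl | rfl | rfl)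
      · left; funext i; simp
      · right; funext i; simp
      · left; funext i; simp
      · right; funext i; simp
    · intro h
      have hx : x = Fin.cons (x 0) (x ∘ Fin.succ) := by
        funext i; refine Fin.cases ?_ (fun j => ?_) i <;> simp
      rw [hx]
      rcases h01 (x 0) with h0 | h0 <;> rcases h with h | h <;> simp [h0, h]

/-- **`L(G(−n))` on the class-`7` family, row by row.** The row of the vertex `−1` vanishes (no prime
`≡ ±3 (mod 8)`), the row of `p₀ ≡ 7 (mod 8)` vanishes (no arcs out of a prime `≡ 3 (mod 4)`), and the row
of `pₐ` (`a ≠ 0`, `pₐ ≡ 1 (mod 4)`) is the row `a` of Monsky's `A` applied to the prime coordinates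
(`kroneckerBit = addLegendreSym`, diagonal = row sum).
[cite: FaulknerJames2007, Def. 1.5 (arcs of G(−n)) and §5 proof of Lemma 5.2] -/
theorem fjLaplacianNeg_mulVec_caseSeven (hp : ∀ i, (p i).Prime) (hinj : Function.Injective p)
    (h7 : p 0 % 8 = 7) (h1 : ∀ i, i ≠ 0 → p i % 8 = 1) (x : Fin (k + 1 + 1) → ZMod 2)
    (i : Fin (k + 1 + 1)) :
    (fjLaplacianNeg p *ᵥ x) i =
      Fin.cases (motive := fun _ => ZMod 2) 0
        (fun a => if a = 0 then 0 else (legendreMatrix p *ᵥ (x ∘ Fin.succ)) a) i := by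
  rw [fjLaplacianNeg_mulVec]
  refine Fin.cases ?_ (fun a => ?_) i
  · -- the row of `−1`
    rw [Fin.sum_univ_succ, fjArcNeg_self, zero_mul, zero_add, Fin.cases_zero]
    refine Finset.sum_eq_zero fun b _ => ?_
    rw [fjArcNeg_zero_succ, if_neg, zero_mul]
    rcases eq_or_ne b 0 with rfl | hb
    · omega
    · have := h1 b hb; omega
  · rw [Fin.cases_succ]
    rcases eq_or_ne a 0 with rfl | ha
    · -- the row of `p₀ ≡ 7 (mod 8)`: no arcs out
      rw [if_pos rfl]
      refine Finset.sum_eq_zero fun l _ => ?_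
      rw [fjArcNeg_succ_of_ne p 0 (by omega), zero_mul]
    · rw [if_neg ha, Fin.sum_univ_succ, fjArcNeg_zero_right, zero_mul, zero_add]
      have h4 : p a % 4 = 1 := mod_four_of_caseSeven p h1 a ha
      have hp2 : p a ≠ 2 := fun h => by rw [h] at h4; omega
      have hξ : ∀ b, b ≠ a → fjArcNeg p a.succ b.succ = legendreMatrix p a b := by
        intro b hb
        rw [fjArcNeg_succ_succ, if_neg hb.symm, if_pos h4, legendreMatrix_apply_of_ne p hb.symm]
        exact kroneckerBit_eq_addLegendreSym (hp a) hp2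
          (natCast_ne_zero_of_prime_ne (hp a) (hp b) fun h => hb (hinj h))
      calc ∑ b : Fin (k + 1), fjArcNeg p a.succ b.succ * (x a.succ + x b.succ)
          = ∑ b ∈ univ.erase a, legendreMatrix p a b * (x a.succ + x b.succ) := by
            rw [← Finset.add_sum_erase _ _ (Finset.mem_univ a), fjArcNeg_self, zero_mul, zero_add]
            exact Finset.sum_congr rfl fun b hb => by rw [hξ b (Finset.ne_of_mem_erase hb)]
        _ = (∑ b ∈ univ.erase a, legendreMatrix p a b) * x a.succ +
              ∑ b ∈ univ.erase a, legendreMatrix p a b * x b.succ := by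
            rw [Finset.sum_mul, ← Finset.sum_add_distrib]
            exact Finset.sum_congr rfl fun b _ => by ring
        _ = ∑ b, legendreMatrix p a b * x b.succ := by
            rw [← legendreMatrix_apply_self,
              ← Finset.add_sum_erase _ (fun b => legendreMatrix p a b * x b.succ) (Finset.mem_univ a)]
        _ = (legendreMatrix p *ᵥ (x ∘ Fin.succ)) a := by
            rw [Matrix.mulVec, dotProduct]; rfl

/-- **Null space of `L(G(−n))` on Tian's class-`7` family** (`G(n)` odd, kernel form `hG`): `L x = 0` iff
the prime coordinates of `x` are constant — only the trivial even partitions, with the vertex `−1` on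
either side: `S′_n = {±1, ±n}`, `ŝ(n) = 0`. [cite: FaulknerJames2007, Thm. 1.2 (2) and Lemma 5.1] [cite: Tian2014, Lemma 5.3 (dim S^{(φ)}(E^{(m)}) = 1)] -/
theorem fjLaplacianNeg_mulVec_eq_zero_iff_caseSeven (hp : ∀ i, (p i).Prime)
    (hinj : Function.Injective p) (h7 : p 0 % 8 = 7) (h1 : ∀ i, i ≠ 0 → p i % 8 = 1)
    (hG : ∀ v, legendreMatrix p *ᵥ v = 0 → v = 0 ∨ v = fun _ => 1) (x : Fin (k + 1 + 1) → ZMod 2) :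
    fjLaplacianNeg p *ᵥ x = 0 ↔ x ∘ Fin.succ = 0 ∨ x ∘ Fin.succ = fun _ => 1 := by
  have hodd := odd_of_caseSeven p h7 h1
  have hsymm := legendreMatrix_transpose_eq p hodd (mod_four_of_caseSeven p h1)
  have hrow := fjLaplacianNeg_mulVec_caseSeven p hp hinj h7 h1 x
  constructor
  · intro hx
    have hAa : ∀ a, a ≠ 0 → (legendreMatrix p *ᵥ (x ∘ Fin.succ)) a = 0 := by
      intro a ha
      have := congr_fun hx a.succ
      rw [hrow, Fin.cases_succ, if_neg ha] at this
      exact this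
    have hA : legendreMatrix p *ᵥ (x ∘ Fin.succ) = 0 := by
      funext a
      rcases eq_or_ne a 0 with rfl | ha
      · have hsum := sum_legendreMatrix_mulVec_eq_zero p hsymm (x ∘ Fin.succ)
        rw [Fin.sum_univ_succ, Finset.sum_eq_zero (fun b _ => hAa _ (Fin.succ_ne_zero b)),
          add_zero] at hsum
        exact hsum
      · exact hAa a ha
    exact hG _ hA
  · intro h
    have hA : legendreMatrix p *ᵥ (x ∘ Fin.succ) = 0 := by
      rcases h with h | h
      · rw [h]; exact Matrix.mulVec_zero _
      · rw [h]; exact legendreMatrix_mulVec_one p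
    funext i
    rw [hrow, Pi.zero_apply]
    refine Fin.cases ?_ (fun a => ?_) i
    · rfl
    · rw [Fin.cases_succ]
      split_ifs
      · rfl
      · rw [hA]; rfl

/-- **`#NS(L(G(−n))) = 4` on Tian's class-`7` family, uniformly in `k`** — the ρ-certificate `hcard` of
`FaulknerJames2007.rhoIndex_eq_one_of_card_ker`, with NO per-`n` `decide`.
[cite: FaulknerJames2007, Thm. 1.2 (2) with Lemma 5.1] [cite: Tian2014, Lemma 5.3 (arXiv p. 28 L71 – p. 29 L31)] -/
theorem card_ker_fjLaplacianNeg_caseSeven (hp : ∀ i, (p i).Prime) (hinj : Function.Injective p)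
    (h7 : p 0 % 8 = 7) (h1 : ∀ i, i ≠ 0 → p i % 8 = 1)
    (hG : ∀ v, legendreMatrix p *ᵥ v = 0 → v = 0 ∨ v = fun _ => 1) :
    Fintype.card {x : Fin (k + 1 + 1) → ZMod 2 // fjLaplacianNeg p *ᵥ x = 0} = 4 := by
  rw [← card_tail_eq_zero_or_one k]
  exact Fintype.card_congr (Equiv.subtypeEquivRight fun x =>
    fjLaplacianNeg_mulVec_eq_zero_iff_caseSeven p hp hinj h7 h1 hG x)

/-- **`ρ(n) = 0` on Tian's class-`7` family, uniformly in `k`:** `[E_n(ℚ) : φ_n(A_n(ℚ)) + E_n[2]] = 1` for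
`n = p₀p₁⋯p_k` (`p₀ ≡ 7`, `pᵢ ≡ 1 (mod 8)`, `G(n)` odd) — Faulkner–James' bound `4·2^{ρ(n)} ≤ #NS(L(G(−n)))`
(`rhoIndex_pos_and_four_mul_le_card_ker`, proved in the tree) with the count `4` of this file.  Extends
`rhoIndex_eq_one_of_prime` (`k = 0`) to every `k`; the input `hρ` of door D-CN-6.
[cite: FaulknerJames2007, Thm. 1.2 (2)] [cite: TianYuanZhang2017, §1, definition of ρ(n) (chunk p0002 L101–L110)]
[cite: Tian2014, Lemma 5.3 (arXiv p. 28 L71 – p. 29 L31)] -/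
theorem rhoIndex_eq_one_caseSeven (hp : ∀ i, (p i).Prime) (hinj : Function.Injective p)
    (h7 : p 0 % 8 = 7) (h1 : ∀ i, i ≠ 0 → p i % 8 = 1)
    (hG : ∀ v, legendreMatrix p *ᵥ v = 0 → v = 0 ∨ v = fun _ => 1) {n : ℕ} (hn : ∏ i, p i = n) :
    (rhoSubgroup n).index = 1 :=
  rhoIndex_eq_one_of_card_ker p hp hinj (Or.inr (prod_mod_eight_caseSeven p h7 h1))
    (card_ker_fjLaplacianNeg_caseSeven p hp hinj h7 h1 hG) hn

/-! ## §3 Tian's Lemma 5.1 (⇐) on the family, modulo Rédei–Reichardt: `G(n)` odd ⟹ condition (1.1) -/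

/-- **Laplacian-type matrices over `𝔽₂`.**  If every diagonal entry is the sum of the other entries of its
row (Monsky's `A`, Rédei's `RM(D)`, Faulkner–James' `L(G)`), then `(M x)_i = Σ_j M_ij (x_i + x_j)` — only
OFF-diagonal entries matter. [cite: FaulknerJames2007, §5 proof of Lemma 5.2 (the Laplace matrix applied to v(V₁))] -/
theorem mulVec_apply_eq_sum_of_diag {ι : Type} [Fintype ι] [DecidableEq ι] (M : Matrix ι ι (ZMod 2))
    (hdiag : ∀ i, M i i = ∑ j ∈ univ.erase i, M i j) (x : ι → ZMod 2) (i : ι) :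
    (M *ᵥ x) i = ∑ j, M i j * (x i + x j) := by
  have hrow : ∑ j, M i j = 0 := by
    rw [← Finset.add_sum_erase _ _ (Finset.mem_univ i), ← hdiag]
    exact CharTwo.add_self_eq_zero _
  rw [Matrix.mulVec, dotProduct]
  symm
  calc ∑ j, M i j * (x i + x j) = ∑ j, (M i j * x i + M i j * x j) :=
        Finset.sum_congr rfl fun j _ => mul_add _ _ _
    _ = (∑ j, M i j) * x i + ∑ j, M i j * x j := by rw [Finset.sum_add_distrib, Finset.sum_mul]
    _ = ∑ j, M i j * x j := by rw [hrow, zero_mul, zero_add]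

/-- `(A ξ)_a = Σ_b A_ab (ξ_a + ξ_b)` for Monsky's `A`. [cite: HeathBrown1994SelmerCongruentII, Appendix (Monsky), typescript p. 39 L13–L26 (A_ii = Σ_{j≠i} A_ij)] -/
theorem legendreMatrix_mulVec_apply_eq_sum (ξ : Fin (k + 1) → ZMod 2) (a : Fin (k + 1)) :
    (legendreMatrix p *ᵥ ξ) a = ∑ b, legendreMatrix p a b * (ξ a + ξ b) :=
  mulVec_apply_eq_sum_of_diag _ (legendreMatrix_apply_self p) ξ a

section RedeiTwoN

variable {n : ℕ}

/-- `D₂ = 8` for `D = −8n`, `n ≡ 7 (mod 8)` (`2n ≡ 6 (mod 8)`; Li–Ma's choice with `∏ Dᵢ = D`).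
[cite: LiMa2008, Lemma 0.1 (p. 279)] -/
theorem primeDisc_two_mul_two (hn8 : n % 8 = 7) : primeDisc (2 * n) 2 = 8 := by
  unfold primeDisc
  rw [if_pos rfl, if_neg (by omega), if_pos (by omega)]

/-- `8 ≠ 0` in `ZMod q` for an odd prime `q`. [cite: IrelandRosen1990, Ch. 5 §2 (definition of the Jacobi symbol)] -/
theorem eight_ne_zero {q : ℕ} (hq : q.Prime) (hq2 : q ≠ 2) : ((8 : ℤ) : ZMod q) ≠ 0 := by
  intro h
  have h8 : ((8 : ℕ) : ZMod q) = 0 := by exact_mod_cast h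
  rw [ZMod.natCast_eq_zero_iff] at h8
  have : q ∣ 2 ^ 3 := by simpa using h8
  exact hq2 ((Nat.prime_dvd_prime_iff_eq hq Nat.prime_two).mp (hq.dvd_of_dvd_pow this))

/-- `(8/q) = (2/q) = +1` for a prime `q ≡ ±1 (mod 8)`: `kroneckerBit 8 q = 0`.
[cite: IrelandRosen1990, Ch. 5 §2 Prop. 5.2.2 (second supplement)] -/
theorem kroneckerBit_eight_eq_zero {q : ℕ} (hq : q.Prime) (h8 : q % 8 = 1 ∨ q % 8 = 7) :
    kroneckerBit 8 q = 0 := by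
  have hq2 : q ≠ 2 := by omega
  have hodd : Odd q := Nat.odd_iff.mpr (by omega)
  rw [kroneckerBit_eq_addLegendreSym hq hq2 (eight_ne_zero hq hq2)]
  apply addLegendreSym_of_eq_one
  have hgcd : Int.gcd 2 q = 1 := by
    have h := Int.gcd_natCast_natCast 2 q
    rw [(Nat.coprime_primes Nat.prime_two hq).mpr (Ne.symm hq2)] at h
    simpa using h
  rw [show (8 : ℤ) = 2 ^ 2 * 2 by norm_num, jacobiSym.mul_left, jacobiSym.pow_left,
    jacobiSym.sq_one hgcd, one_mul]
  exact jacobiSym_two_eq_one h8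

/-- Row of the prime `2` in `RM(−8n)` on the class-`7` family: `(D_b/2)`-bits vanish (`p_b ≡ 1 (mod 8)` gives
`D_b = p_b ≡ 1`; `p₀ ≡ 7` gives `D₀ = −p₀ ≡ 1 (mod 8)`). [cite: LiMa2008, Def. 0.2 (p. 279)] [cite: Cox2013, §5.B ((D/2) = −1 iff D ≡ 5 mod 8)] -/
theorem redeiMatrix_two_mul_zero_succ (h7 : p 0 % 8 = 7)
    (h1 : ∀ i, i ≠ 0 → p i % 8 = 1) (b : Fin (k + 1)) :
    redeiMatrix (2 * n) (Fin.cons 2 p) 0 b.succ = 0 := by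
  have hp2 : p b ≠ 2 := fun h => by
    have := odd_of_caseSeven p h7 h1 b; rw [h] at this; exact (Nat.not_odd_iff_even.mpr even_two) this
  rw [redeiMatrix_apply_of_ne _ _ (Fin.succ_ne_zero b).symm, Fin.cons_zero, Fin.cons_succ,
    kroneckerBit_two, primeDisc_of_ne_two _ hp2]
  rcases eq_or_ne b 0 with rfl | hb
  · rw [if_neg (show ¬ p 0 % 4 = 1 by omega), if_neg]
    have : ((p 0 : ℕ) : ℤ) % 8 = 7 := by exact_mod_cast h7
    omega
  · rw [if_pos (mod_four_of_caseSeven p h1 b hb), if_neg]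
    have := h1 b hb
    have : ((p b : ℕ) : ℤ) % 8 = 1 := by exact_mod_cast this
    omega

/-- Column of the prime `2` in `RM(−8n)` on the class-`7` family: `(8/pₐ) = +1` for `pₐ ≡ ±1 (mod 8)`.
[cite: LiMa2008, Def. 0.2 (p. 279)] [cite: IrelandRosen1990, Ch. 5 §2 Prop. 5.2.2] -/
theorem redeiMatrix_two_mul_succ_zero (hp : ∀ i, (p i).Prime) (h7 : p 0 % 8 = 7)
    (h1 : ∀ i, i ≠ 0 → p i % 8 = 1) (hn8 : n % 8 = 7) (a : Fin (k + 1)) :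
    redeiMatrix (2 * n) (Fin.cons 2 p) a.succ 0 = 0 := by
  rw [redeiMatrix_apply_of_ne _ _ (Fin.succ_ne_zero a), Fin.cons_zero, Fin.cons_succ,
    primeDisc_two_mul_two hn8]
  refine kroneckerBit_eight_eq_zero (hp a) ?_
  rcases eq_or_ne a 0 with rfl | ha
  · exact Or.inr h7
  · exact Or.inl (h1 a ha)

/-- Prime-to-prime entries of `RM(−8n)` on the class-`7` family are Monsky's `A`: `[(D_b/pₐ) = −1] = [(p_b/pₐ) = −1]`
(`D_b = p_b` for `b ≠ 0`; `D₀ = −p₀` and `(−1/pₐ) = +1` for `a ≠ 0`).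
[cite: LiMa2008, Def. 0.2 (p. 279)] [cite: IrelandRosen1990, Ch. 5 §2 Prop. 5.2.2 and Thm. 2] -/
theorem redeiMatrix_two_mul_succ_succ (hp : ∀ i, (p i).Prime) (hinj : Function.Injective p)
    (h7 : p 0 % 8 = 7) (h1 : ∀ i, i ≠ 0 → p i % 8 = 1) {a b : Fin (k + 1)} (hab : a ≠ b) :
    redeiMatrix (2 * n) (Fin.cons 2 p) a.succ b.succ = legendreMatrix p a b := by
  have hodd := odd_of_caseSeven p h7 h1
  have hp2 : ∀ i, p i ≠ 2 := fun i h => by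
    have := hodd i; rw [h] at this; exact (Nat.not_odd_iff_even.mpr even_two) this
  have hne : (((p b : ℕ) : ℤ) : ZMod (p a)) ≠ 0 :=
    natCast_ne_zero_of_prime_ne (hp a) (hp b) fun h => hab.symm (hinj h)
  rw [redeiMatrix_apply_of_ne _ _ (fun h => hab (Fin.succ_inj.mp h)), Fin.cons_succ, Fin.cons_succ,
    primeDisc_of_ne_two _ (hp2 b), legendreMatrix_apply_of_ne p hab]
  rcases eq_or_ne b 0 with rfl | hb
  · -- `D₀ = −p₀`; `a ≠ 0` so `pₐ ≡ 1 (mod 4)` and `(−p₀/pₐ) = (p₀/pₐ)`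
    have h4 : p a % 4 = 1 := mod_four_of_caseSeven p h1 a hab
    rw [if_neg (show ¬ p 0 % 4 = 1 by omega),
      kroneckerBit_eq_addLegendreSym (hp a) (hp2 a) (by rw [Int.cast_neg]; exact neg_ne_zero.mpr hne),
      addLegendreSym_def,
      addLegendreSym_def, jacobiSym.neg _ (hodd a), ZMod.χ₄_nat_one_mod_four h4, one_mul]
  · rw [if_pos (mod_four_of_caseSeven p h1 b hb)]
    exact kroneckerBit_eq_addLegendreSym (hp a) (hp2 a) hne

/-- **`RM(−8n)` applied to a vector, on the class-`7` family:** the coordinate of `2` is `0` and the prime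
coordinates are `A` applied to the prime part — `RM(−8n) = (0 0; 0 A)` in the basis `(2; p₀, …, p_k)`.
[cite: LiMa2008, Def. 0.2 (p. 279); evaluation ours] [cite: Tian2014, proof of Lemma 5.1 (arXiv p. 28: the Rédei matrix of ℚ(√−2n) via the graph)] -/
theorem redeiMatrix_two_mul_mulVec (hp : ∀ i, (p i).Prime) (hinj : Function.Injective p)
    (h7 : p 0 % 8 = 7) (h1 : ∀ i, i ≠ 0 → p i % 8 = 1) (hn8 : n % 8 = 7)
    (x : Fin (k + 1 + 1) → ZMod 2) (i : Fin (k + 1 + 1)) :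
    (redeiMatrix (2 * n) (Fin.cons 2 p) *ᵥ x) i =
      Fin.cases (motive := fun _ => ZMod 2) 0 (fun a => (legendreMatrix p *ᵥ (x ∘ Fin.succ)) a) i := by
  rw [mulVec_apply_eq_sum_of_diag _ (redeiMatrix_apply_self _ _) x i, Fin.sum_univ_succ]
  refine Fin.cases ?_ (fun a => ?_) i
  · rw [Fin.cases_zero, CharTwo.add_self_eq_zero, mul_zero, zero_add]
    exact Finset.sum_eq_zero fun b _ => by rw [redeiMatrix_two_mul_zero_succ p h7 h1 b, zero_mul]
  · rw [Fin.cases_succ, redeiMatrix_two_mul_succ_zero p hp h7 h1 hn8 a, zero_mul, zero_add,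
      legendreMatrix_mulVec_apply_eq_sum]
    refine Finset.sum_congr rfl fun b _ => ?_
    rcases eq_or_ne a b with rfl | hab
    · simp only [Function.comp_apply, CharTwo.add_self_eq_zero, mul_zero]
    · rw [redeiMatrix_two_mul_succ_succ p hp hinj h7 h1 hab]; rfl

/-- **Kernel of `RM(−8n)` on Tian's class-`7` family = `{x : (x_{p₀}, …, x_{p_k}) ∈ {0, 1}}`** (`G(n)` odd,
kernel form): `4` elements. [cite: Tian2014, Lemma 5.1 (arXiv p. 28 L2–L16)] [cite: LiMa2008, Thm. 0.4 (p. 280)] -/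
theorem card_ker_redeiMatrix_two_mul_caseSeven (hp : ∀ i, (p i).Prime) (hinj : Function.Injective p)
    (h7 : p 0 % 8 = 7) (h1 : ∀ i, i ≠ 0 → p i % 8 = 1)
    (hG : ∀ v, legendreMatrix p *ᵥ v = 0 → v = 0 ∨ v = fun _ => 1) (hn8 : n % 8 = 7) :
    Fintype.card {x : Fin (k + 1 + 1) → ZMod 2 // redeiMatrix (2 * n) (Fin.cons 2 p) *ᵥ x = 0} = 4 := by
  rw [← card_tail_eq_zero_or_one k]
  refine Fintype.card_congr (Equiv.subtypeEquivRight fun x => ?_)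
  have hrow := redeiMatrix_two_mul_mulVec p hp hinj h7 h1 hn8 x
  constructor
  · intro hx
    refine hG _ (funext fun a => ?_)
    have := congr_fun hx a.succ
    rw [hrow, Fin.cases_succ] at this
    exact this
  · intro h
    have hA : legendreMatrix p *ᵥ (x ∘ Fin.succ) = 0 := by
      rcases h with h | h
      · rw [h]; exact Matrix.mulVec_zero _
      · rw [h]; exact legendreMatrix_mulVec_one p
    funext i
    rw [hrow, Pi.zero_apply]
    refine Fin.cases rfl (fun a => ?_) i
    rw [Fin.cases_succ, hA]; rfl

end RedeiTwoN

/-- **Tian 2014, Lemma 5.1 (direction ⇐) for the class-`7` family, as a THEOREM modulo Rédei–Reichardt.**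
For `n = p₀p₁⋯p_k` with `p₀ ≡ 7`, `pᵢ ≡ 1 (mod 8)` and `G(n)` odd (Feng's kernel form `hG`: "odd number of
spanning subtrees" ⟺ "no proper even partition"), every quadratic field `K ∋ √−2n` satisfies Tian's
condition (1.1): `dim_{𝔽₂} 𝒜[4]/𝒜[2] = 1` (`n ≢ ±3 (mod 8)`), i.e. `#(2𝒜 ∩ 𝒜[2]) = 2` — `Condition11 n K`.
Route: `RM(−8n)` on `(2; p₀, …, p_k)` is `(0 0; 0 A)` (§3), its kernel has `4 = 2^{1+1}` elements, and the
displayed fact gives `#(2𝒜 ∩ 𝒜[2]) = 2^{t − 1 − rank} = 2`.  So the HYPOTHESIS (1.1) of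
`thm13_rank_one_and_sha_odd` is discharged uniformly on this family.
[cite: Tian2014, Lemma 5.1 (arXiv:1210.8231 p. 28, L2–L16) and Thm. 1.3 (1.1)] [cite: LiMa2008, Thm. 0.4 (p. 280)] -/
theorem condition11_caseSeven (hR : redeiReichardt_fourTwoCard_classGroup) (hp : ∀ i, (p i).Prime)
    (hinj : Function.Injective p) (h7 : p 0 % 8 = 7) (h1 : ∀ i, i ≠ 0 → p i % 8 = 1)
    (hG : ∀ v, legendreMatrix p *ᵥ v = 0 → v = 0 ∨ v = fun _ => 1) {n : ℕ} (hn : ∏ i, p i = n)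
    (K : Type) [Field K] [NumberField K] (hK : IsQuadraticFieldOfSqrt K (-(2 * n : ℤ))) :
    Condition11 n K := by
  have hn8 : n % 8 = 7 := hn ▸ prod_mod_eight_caseSeven p h7 h1
  have hodd := odd_of_caseSeven p h7 h1
  refine condition11_of_card_ker (p := Fin.cons 2 p) hR ?_ ?_ ?_ ?_ K hK
  · intro i
    refine Fin.cases ?_ (fun a => ?_) i
    · exact Nat.prime_two
    · rw [Fin.cons_succ]; exact hp a
  · refine Fin.cons_injective_iff.mpr ⟨?_, hinj⟩
    rintro ⟨a, ha⟩
    have := hodd a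
    rw [ha] at this
    exact (Nat.not_odd_iff_even.mpr even_two) this
  · rw [Fin.prod_univ_succ, Fin.cons_zero]
    simp only [Fin.cons_succ]
    rw [hn]
  · rw [if_neg (by omega)]
    exact card_ker_redeiMatrix_two_mul_caseSeven p hp hinj h7 h1 hG hn8

/-! ## §4 The genus condition of Tian–Yuan–Zhang Thm 1.2 on the family, modulo Rédei–Reichardt: `Σ₁(n)` is odd -/

section GenusGeneral

/-- **Rédei on an arbitrary finite index type** (Literature twin of the sub-lane's
`P2/CongruentNumberPairsAtTwoGenusRedei.lean` §1, for ANY quadratic `K ∋ √−d`).  Modulo Rédei–Reichardt: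
for an injective prime family `q : ι → ℕ` with `∏ q = d` (`d ≢ 1 (mod 4)`) resp. `2d` (`d ≡ 1 (mod 4)`),
`g(K) = #2Cl(K)` is odd iff the Rédei matrix written on `ι` has a `2`-element kernel (`r₄ = 0`).
[cite: LiMa2008, Thm. 0.4 (p. 280) with Def. 0.2 (p. 279)] [cite: TianYuanZhang2017, §1 (p0002 L78–L85: g(d); "g(d) odd iff no class of exact order 4")] -/
theorem odd_genusClassNumber_iff_card_ker_of_redeiReichardt (hR : redeiReichardt_fourTwoCard_classGroup)
    {ι : Type} [Fintype ι] [DecidableEq ι] (q : ι → ℕ) (hq : ∀ a, (q a).Prime)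
    (hinj : Function.Injective q) {d : ℕ} (hprod : ∏ a, q a = if d % 4 = 1 then 2 * d else d)
    (K : Type) [Field K] [NumberField K] (hK : IsQuadraticFieldOfSqrt K (-(d : ℤ))) :
    Odd (genusClassNumber K) ↔
      Fintype.card {v : ι → ZMod 2 // (Matrix.of fun a b : ι =>
        if a = b then ∑ c ∈ univ.erase a, kroneckerBit (primeDisc d (q c)) (q a)
        else kroneckerBit (primeDisc d (q b)) (q a)) *ᵥ v = 0} = 2 := by
  set e : Fin (Fintype.card ι) ≃ ι := (Fintype.equivFin ι).symm with he
  set R : Matrix ι ι (ZMod 2) := Matrix.of fun a b : ι =>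
    if a = b then ∑ c ∈ univ.erase a, kroneckerBit (primeDisc d (q c)) (q a)
    else kroneckerBit (primeDisc d (q b)) (q a) with hRdef
  have hsub : redeiMatrix d (q ∘ e) = R.submatrix e e := by
    ext i j
    simp only [redeiMatrix, hRdef, Matrix.submatrix_apply, Matrix.of_apply, Function.comp_apply,
      EmbeddingLike.apply_eq_iff_eq]
    split_ifs with h
    · exact Finset.sum_equiv e (fun c => by simp [Finset.mem_erase, e.injective.eq_iff])
        (fun c _ => rfl)
    · rfl
  have hprod' : ∏ i, (q ∘ e) i = if d % 4 = 1 then 2 * d else d := by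
    rw [← hprod]; exact e.prod_comp (fun a => q a)
  have hq' : ∀ i, ((q ∘ e) i).Prime := fun i => hq (e i)
  have hinj' : Function.Injective (q ∘ e) := hinj.comp e.injective
  rw [odd_genusClassNumber_iff_of_redeiReichardt hR hq' hinj' hprod' K hK]
  have hker := card_ker_mulVec_eq (redeiMatrix d (q ∘ e))
  have hrk := rank_redeiMatrix_le d (q ∘ e) (pos_of_prod_eq hprod')
  have hiff : ∀ v : ι → ZMod 2, R *ᵥ v = 0 ↔ redeiMatrix d (q ∘ e) *ᵥ (v ∘ e) = 0 := by
    intro v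
    have hv : (v ∘ ⇑e) ∘ ⇑e.symm = v := by ext a; simp
    rw [hsub, Matrix.submatrix_mulVec_equiv, hv]
    constructor
    · intro h; ext i; simp [h]
    · intro h; ext a
      have := congr_fun h (e.symm a)
      simpa using this
  have hcardι : Fintype.card {v : ι → ZMod 2 // R *ᵥ v = 0} =
      Fintype.card {w : Fin (Fintype.card ι) → ZMod 2 // redeiMatrix d (q ∘ e) *ᵥ w = 0} := by
    refine Fintype.card_congr ⟨fun v => ⟨v.1 ∘ e, (hiff v.1).mp v.2⟩,
      fun w => ⟨w.1 ∘ e.symm, (hiff _).mpr ?_⟩, fun v => ?_, fun w => ?_⟩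
    · have hw : (w.1 ∘ ⇑e.symm) ∘ ⇑e = w.1 := by ext i; simp
      rw [hw]; exact w.2
    · ext a; simp
    · ext i; simp
  rw [hcardι, hker]
  have ht : Fintype.card ι - (redeiMatrix d (q ∘ e)).rank =
      (Fintype.card ι - 1 - (redeiMatrix d (q ∘ e)).rank) + 1 := by
    have := pos_of_prod_eq hprod'
    omega
  rw [ht, pow_succ]
  constructor
  · intro h; rw [h]; rfl
  · intro h
    by_contra hne
    have : 2 ≤ 2 ^ (Fintype.card ι - 1 - (redeiMatrix d (q ∘ e)).rank) := le_self_pow₀ (by norm_num) hne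
    omega

end GenusGeneral

/-- For distinct primes `p₀, …, p_k` and `d ∣ p₀⋯p_k`, `d` is the product of the `pᵢ` dividing it.
[cite: HardyWright2008, §17.8 (square-free numbers)] -/
theorem prod_subtype_dvd_eq (hp : ∀ i, (p i).Prime) (hinj : Function.Injective p) {d : ℕ}
    (hd : d ∣ ∏ i, p i) : ∏ a : {i : Fin (k + 1) // p i ∣ d}, p a.1 = d := by
  have hsq : Squarefree d :=
    Squarefree.squarefree_of_dvd hd (squarefree_prod_of_injective p hp hinj)
  have himg : (univ.filter fun i => p i ∣ d).image p = d.primeFactors := by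
    ext r
    simp only [Finset.mem_image, Finset.mem_filter, Finset.mem_univ, true_and,
      Nat.mem_primeFactors_of_ne_zero hsq.ne_zero]
    constructor
    · rintro ⟨i, hi, rfl⟩; exact ⟨hp i, hi⟩
    · rintro ⟨hr, hrd⟩
      obtain ⟨i, -, hi⟩ := ((Nat.Prime.prime hr).dvd_finsetProd_iff _).mp (hrd.trans hd)
      exact ⟨i, ((Nat.prime_dvd_prime_iff_eq hr (hp i)).mp hi) ▸ hrd,
        ((Nat.prime_dvd_prime_iff_eq hr (hp i)).mp hi).symm⟩
  calc ∏ a : {i : Fin (k + 1) // p i ∣ d}, p a.1 = ∏ i ∈ univ.filter (fun i => p i ∣ d), p i :=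
        (Finset.prod_subtype (univ.filter fun i => p i ∣ d) (p := fun i => p i ∣ d)
          (fun i => by simp) (fun i => p i)).symm
    _ = ∏ r ∈ (univ.filter fun i => p i ∣ d).image p, r := by
        rw [Finset.prod_image fun i _ j _ h => hinj h]
    _ = d := by rw [himg, Nat.prod_primeFactors_of_squarefree hsq]

/-- **`g(d)` is EVEN for every divisor `d > 1` of `p₁⋯p_k`** (primes `≡ 1 (mod 8)`), modulo Rédei–Reichardt,
for every quadratic `K ∋ √−d`: `d ≡ 1 (mod 8)`, `disc K = −4d`, and in `RM(−4d)` the row AND the column of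
the prime `2` vanish (`(p/2)`-bits vanish for `p ≡ 1 (mod 8)`; `(−4/p) = +1` for `p ≡ 1 (mod 4)`), so the
kernel contains `0`, `e₂`, `(1,…,1)` — three elements, not two: `r₄ ≥ 1`.  This is the mechanism of
Tian–Yuan–Zhang's proof of Cor. 1.4 ("by Rédei, `g(d)` is even for …").
[cite: TianYuanZhang2017, proof of Cor. 1.4 (chunk p0003 L36–L49)] [cite: LiMa2008, Thm. 0.4 with Lemma 0.1 (D = −4d, D₂ = −4)] -/
theorem even_genusClassNumber_of_dvd_caseSeven (hR : redeiReichardt_fourTwoCard_classGroup)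
    (hp : ∀ i, (p i).Prime) (hinj : Function.Injective p)
    (h1 : ∀ i, i ≠ 0 → p i % 8 = 1) {d : ℕ} (hd : d ∣ ∏ i, p i) (h0 : ¬ p 0 ∣ d) (hd1 : 1 < d)
    (K : Type) [Field K] [NumberField K] (hK : IsQuadraticFieldOfSqrt K (-(d : ℤ))) :
    Even (genusClassNumber K) := by
  -- the index type of the odd primes of `d` and the tuple `(2; pᵢ ∣ d)`
  set S := {i : Fin (k + 1) // p i ∣ d} with hS
  have hi0 : ∀ a : S, a.1 ≠ 0 := fun a h => h0 (h ▸ a.2)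
  have h8S : ∀ a : S, p a.1 % 8 = 1 := fun a => h1 _ (hi0 a)
  have hdprod : ∏ a : S, p a.1 = d := prod_subtype_dvd_eq p hp hinj hd
  have hd8 : d % 8 = 1 := by
    rw [← hdprod, Finset.prod_nat_mod]
    simp only [h8S, Finset.prod_const_one, Nat.one_mod]
  have hd4 : d % 4 = 1 := by omega
  have hne : Nonempty S := by
    by_contra h
    rw [not_nonempty_iff] at h
    rw [Fintype.prod_empty] at hdprod
    omega
  obtain ⟨a₀⟩ := hne
  set q : Option S → ℕ := fun o => o.elim 2 fun a => p a.1 with hq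
  have hqp : ∀ o, (q o).Prime := by
    rintro (_ | a)
    · exact Nat.prime_two
    · exact hp a.1
  have hqinj : Function.Injective q := by
    rintro (_ | a) (_ | b) h
    · rfl
    · exfalso
      have h2 : p b.1 = 2 := by simpa [hq] using h.symm
      have := h8S b; omega
    · exfalso
      have h2 : p a.1 = 2 := by simpa [hq] using h
      have := h8S a; omega
    · simp only [hq, Option.elim_some] at h
      exact congrArg some (Subtype.ext (hinj h))
  have hqprod : ∏ o, q o = if d % 4 = 1 then 2 * d else d := by
    rw [if_pos hd4, Fintype.prod_option]
    simp only [hq, Option.elim_none, Option.elim_some]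
    rw [hdprod]
  -- the Rédei matrix on `Option S` and three of its null vectors
  set M : Matrix (Option S) (Option S) (ZMod 2) := Matrix.of fun a b : Option S =>
    if a = b then ∑ c ∈ univ.erase a, kroneckerBit (primeDisc d (q c)) (q a)
    else kroneckerBit (primeDisc d (q b)) (q a) with hM
  have hdiag : ∀ a, M a a = ∑ c ∈ univ.erase a, M a c := by
    intro a
    simp only [hM, Matrix.of_apply]
    exact Finset.sum_congr rfl fun c hc => by rw [if_neg (Finset.ne_of_mem_erase hc).symm]
  have hrow2 : ∀ a : S, M none (some a) = 0 := by
    intro a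
    have h2 : p a.1 ≠ 2 := by have := h8S a; omega
    simp only [hM, Matrix.of_apply, reduceCtorEq, if_false, hq, Option.elim_none, Option.elim_some]
    rw [primeDisc_of_ne_two _ h2, if_pos (by have := h8S a; omega)]
    exact kroneckerBit_two_of_mod_eight_one (h8S a)
  have hcol2 : ∀ a : S, M (some a) none = 0 := by
    intro a
    simp only [hM, Matrix.of_apply, reduceCtorEq, if_false, hq, Option.elim_none, Option.elim_some]
    have : primeDisc d 2 = -4 := by unfold primeDisc; rw [if_pos rfl, if_pos hd4]
    rw [this]
    exact kroneckerBit_neg_four_eq_zero (hp a.1) (by have := h8S a; omega)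
  set e₂ : Option S → ZMod 2 := fun o => o.elim 1 fun _ => 0 with he₂
  have hMe : M *ᵥ e₂ = 0 := by
    funext o
    rw [mulVec_apply_eq_sum_of_diag M hdiag, Pi.zero_apply, Fintype.sum_option]
    rcases o with _ | a
    · simp only [he₂, Option.elim_none, Option.elim_some, CharTwo.add_self_eq_zero, mul_zero, zero_add,
        add_zero, mul_one]
      exact Finset.sum_eq_zero fun a _ => hrow2 a
    · simp only [he₂, Option.elim_none, Option.elim_some, zero_add, mul_one, add_zero, mul_zero,
        Finset.sum_const_zero, hcol2 a]
  have hM1 : M *ᵥ (fun _ => (1 : ZMod 2)) = 0 := by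
    funext o
    rw [mulVec_apply_eq_sum_of_diag M hdiag, Pi.zero_apply]
    simp only [CharTwo.add_self_eq_zero, mul_zero, Finset.sum_const_zero]
  have hM0 : M *ᵥ (0 : Option S → ZMod 2) = 0 := Matrix.mulVec_zero _
  have h3 : ({⟨0, hM0⟩, ⟨e₂, hMe⟩, ⟨fun _ => 1, hM1⟩} :
      Finset {v : Option S → ZMod 2 // M *ᵥ v = 0}).card = 3 := by
    rw [Finset.card_insert_of_notMem, Finset.card_pair]
    · intro h
      have := congr_fun (congrArg Subtype.val h) (some a₀)
      simp [he₂] at this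
    · simp only [Finset.mem_insert, Finset.mem_singleton, not_or]
      refine ⟨fun h => ?_, fun h => ?_⟩
      · have := congr_fun (congrArg Subtype.val h) none
        simp [he₂] at this
      · have := congr_fun (congrArg Subtype.val h) none
        simp at this
  have hle := Finset.card_le_univ ({⟨0, hM0⟩, ⟨e₂, hMe⟩, ⟨fun _ => 1, hM1⟩} :
      Finset {v : Option S → ZMod 2 // M *ᵥ v = 0})
  rw [h3] at hle
  have key := odd_genusClassNumber_iff_card_ker_of_redeiReichardt hR q hqp hqinj hqprod K hK
  rw [← Nat.not_odd_iff_even]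
  intro hodd
  have h2 := key.mp hodd
  change Fintype.card {v : Option S → ZMod 2 // M *ᵥ v = 0} = 2 at h2
  omega

/-- The Rédei matrix `RM(−n)` of `ℚ(√−n)` on the class-`7` family IS Monsky's `A`: `D_b = p_b` (`b ≠ 0`),
`D₀ = −p₀` with `(−1/pₐ) = +1`, and Euler's bit = the additive Legendre symbol.
[cite: LiMa2008, Def. 0.2 (p. 279)] [cite: HeathBrown1994SelmerCongruentII, Appendix (Monsky), typescript p. 39 L13–L26] -/
theorem redeiMatrix_eq_legendreMatrix_caseSeven (hp : ∀ i, (p i).Prime) (hinj : Function.Injective p)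
    (h7 : p 0 % 8 = 7) (h1 : ∀ i, i ≠ 0 → p i % 8 = 1) (n : ℕ) :
    redeiMatrix n p = legendreMatrix p := by
  have hodd := odd_of_caseSeven p h7 h1
  have hp2 : ∀ i, p i ≠ 2 := fun i h => by
    have := hodd i; rw [h] at this; exact (Nat.not_odd_iff_even.mpr even_two) this
  have hoff : ∀ a b, a ≠ b → redeiMatrix n p a b = legendreMatrix p a b := by
    intro a b hab
    have hne : (((p b : ℕ) : ℤ) : ZMod (p a)) ≠ 0 :=
      natCast_ne_zero_of_prime_ne (hp a) (hp b) fun h => hab.symm (hinj h)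
    rw [redeiMatrix_apply_of_ne _ _ hab, primeDisc_of_ne_two _ (hp2 b), legendreMatrix_apply_of_ne p hab]
    rcases eq_or_ne b 0 with rfl | hb
    · have h4 : p a % 4 = 1 := mod_four_of_caseSeven p h1 a hab
      rw [if_neg (show ¬ p 0 % 4 = 1 by omega),
        kroneckerBit_eq_addLegendreSym (hp a) (hp2 a) (by rw [Int.cast_neg]; exact neg_ne_zero.mpr hne),
        addLegendreSym_def, addLegendreSym_def, jacobiSym.neg _ (hodd a), ZMod.χ₄_nat_one_mod_four h4,
        one_mul]
    · rw [if_pos (mod_four_of_caseSeven p h1 b hb)]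
      exact kroneckerBit_eq_addLegendreSym (hp a) (hp2 a) hne
  ext a b
  rcases eq_or_ne a b with rfl | hab
  · rw [redeiMatrix_apply_self, legendreMatrix_apply_self]
    exact Finset.sum_congr rfl fun c hc => hoff a c (Finset.ne_of_mem_erase hc).symm
  · exact hoff a b hab

/-- Feng's kernel form of "`G(n)` odd" gives the kernel COUNT `2` for `A`. [cite: Feng1996NonCongruent, §2 Lemma 2.2 (p. 74)] -/
theorem card_ker_legendreMatrix_of_oddGraph
    (hG : ∀ v, legendreMatrix p *ᵥ v = 0 → v = 0 ∨ v = fun _ => 1) :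
    Fintype.card {v : Fin (k + 1) → ZMod 2 // legendreMatrix p *ᵥ v = 0} = 2 := by
  rw [Fintype.card_of_subtype ({0, fun _ => 1} : Finset (Fin (k + 1) → ZMod 2)) (fun v => by
    rw [Finset.mem_insert, Finset.mem_singleton]
    constructor
    · rintro (rfl | rfl)
      · exact Matrix.mulVec_zero _
      · exact legendreMatrix_mulVec_one p
    · exact hG v)]
  refine Finset.card_pair fun h => ?_
  exact zero_ne_one (congr_fun h 0)

/-- "`G(n)` odd" in RANK form from the kernel form: `rank_{𝔽₂} A = k = t − 1` (Feng's Lemma 2.2, converse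
direction to `eq_zero_or_eq_one_of_rank_eq`). [cite: Feng1996NonCongruent, §2 Lemma 2.2 (p. 74)] -/
theorem rank_legendreMatrix_of_oddGraph
    (hG : ∀ v, legendreMatrix p *ᵥ v = 0 → v = 0 ∨ v = fun _ => 1) :
    (legendreMatrix p).rank = k := by
  have h := card_ker_mulVec_eq (legendreMatrix p)
  rw [card_ker_legendreMatrix_of_oddGraph p hG] at h
  have hle : (legendreMatrix p).rank ≤ k + 1 := by
    have := Matrix.rank_le_card_width (legendreMatrix p)
    simpa [Fintype.card_fin] using this
  by_contra hne
  rcases Nat.lt_or_gt_of_ne hne with hlt | hgt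
  · have : (2 : ℕ) ^ 2 ≤ 2 ^ (k + 1 - (legendreMatrix p).rank) :=
      Nat.pow_le_pow_right two_pos (by omega)
    omega
  · have h0 : k + 1 - (legendreMatrix p).rank = 0 := by omega
    rw [h0, pow_zero] at h
    omega

/-- **`g(n) = #2Cl(K)` is ODD for `K ∋ √−n` on the class-`7` family** (`G(n)` odd), modulo Rédei–Reichardt:
`disc K = −n`, `RM(−n) = A` has rank `t − 1`, `r₄ = 0` — Tian–Yuan–Zhang's hypothesis "ℚ(√−n) has no ideal
class of exact order `4`" of Cor. 1.4, uniformly. [cite: TianYuanZhang2017, Cor. 1.4 and §1 (p0002 L85: "g(d) odd iff no class of exact order 4")] [cite: LiMa2008, Thm. 0.4 (p. 280)] -/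
theorem odd_genusClassNumber_caseSeven (hR : redeiReichardt_fourTwoCard_classGroup)
    (hp : ∀ i, (p i).Prime) (hinj : Function.Injective p) (h7 : p 0 % 8 = 7)
    (h1 : ∀ i, i ≠ 0 → p i % 8 = 1) (hG : ∀ v, legendreMatrix p *ᵥ v = 0 → v = 0 ∨ v = fun _ => 1)
    {n : ℕ} (hn : ∏ i, p i = n) (K : Type) [Field K] [NumberField K]
    (hK : IsQuadraticFieldOfSqrt K (-(n : ℤ))) : Odd (genusClassNumber K) := by
  have hn4 : n % 4 = 3 := hn ▸ prod_mod_four_caseSeven p h7 h1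
  have hprod : ∏ i, p i = if n % 4 = 1 then 2 * n else n := by rw [if_neg (by omega), hn]
  rw [odd_genusClassNumber_iff_of_redeiReichardt hR hp hinj hprod K hK,
    redeiMatrix_eq_legendreMatrix_caseSeven p hp hinj h7 h1 n, rank_legendreMatrix_of_oddGraph p hG]
  omega

/-- **Decompositions split a prime.**  If a prime `q ∣ n` divided every factor of a decomposition
`n = d₀⋯d_ℓ` (pairwise coprime factors `> 1`), there would be exactly one factor: so every decomposition
other than `{n}` has a factor prime to `q`. [cite: TianYuanZhang2017, Thm. 1.1 ("all decompositions n = d₀⋯d_ℓ are non-ordered with dᵢ > 1")] -/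
theorem exists_mem_not_dvd_of_mem_decompositions {n q : ℕ} (hq : q.Prime) (hqn : q ∣ n)
    {D : Finset ℕ} (hD : D ∈ decompositions n) (hDn : D ≠ {n}) : ∃ d ∈ D, ¬ q ∣ d := by
  simp only [decompositions, Finset.mem_filter, Finset.mem_powerset] at hD
  obtain ⟨-, hgt, hcop, hprod⟩ := hD
  by_contra h
  push Not at h
  have hcard : D.card ≤ 1 := by
    refine Finset.card_le_one.mpr fun a ha b hb => ?_
    by_contra hab
    have hc : Nat.Coprime a b := hcop ha hb hab
    have : q ∣ Nat.gcd a b := Nat.dvd_gcd (h a ha) (h b hb)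
    rw [hc] at this
    exact hq.one_lt.ne' (Nat.dvd_one.mp this)
  rcases D.eq_empty_or_nonempty with rfl | ⟨a, ha⟩
  · rw [Finset.prod_empty] at hprod
    rw [← hprod] at hqn
    exact hq.one_lt.ne' (Nat.dvd_one.mp hqn)
  · have hDa : D = {a} := Finset.eq_singleton_iff_unique_mem.mpr
      ⟨ha, fun b hb => Finset.card_le_one.mp hcard b hb a ha⟩
    rw [hDa, Finset.prod_singleton] at hprod
    exact hDn (by rw [hDa, hprod])

/-- `{n}` is a decomposition of `n > 1`. [cite: TianYuanZhang2017, Thm. 1.1 (the term ℓ = 0 of the genus sum)] -/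
theorem singleton_mem_decompositions {n : ℕ} (hn : 1 < n) : {n} ∈ decompositions n := by
  simp only [decompositions, Finset.mem_filter, Finset.mem_powerset, Finset.singleton_subset_iff,
    Nat.mem_divisors, dvd_refl, true_and, Finset.mem_singleton, forall_eq, Finset.coe_singleton,
    Set.pairwise_singleton, Finset.prod_singleton, and_true]
  exact ⟨by omega, hn⟩

/-- **The genus condition of TYZ Thm 1.2 holds on Tian's class-`7` family** (modulo Rédei–Reichardt): for
`n = p₀p₁⋯p_k` (`p₀ ≡ 7`, `pᵢ ≡ 1 (mod 8)`, `G(n)` odd) the first genus sum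
`Σ₁(n) = Σ_{n = d₀⋯d_ℓ, dᵢ ≡ 1 (8) for i > 0} ∏ g(dᵢ)` over the fields `K_d = GenusField d` is ODD.  Indeed every
decomposition other than `{n}` has a factor `d > 1` prime to `p₀`, i.e. `d ∣ p₁⋯p_k`, whose `g(d)` is even;
and `g(n)` is odd.  (Tian–Yuan–Zhang's Cor. 1.4, case `n ≡ 7 (mod 8)` with `A₁`: one prime `≡ 3 (mod 4)`.)
The input `hgen` of door D-CN-6, uniformly in `k`.
[cite: TianYuanZhang2017, Thm. 1.2 (Σ₁) and proof of Cor. 1.4 (chunk p0003 L13–L49)] [cite: LiMa2008, Thm. 0.4] -/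
theorem odd_genusSum₁_caseSeven (hR : redeiReichardt_fourTwoCard_classGroup) (hp : ∀ i, (p i).Prime)
    (hinj : Function.Injective p) (h7 : p 0 % 8 = 7) (h1 : ∀ i, i ≠ 0 → p i % 8 = 1)
    (hG : ∀ v, legendreMatrix p *ᵥ v = 0 → v = 0 ∨ v = fun _ => 1) {n : ℕ} (hn : ∏ i, p i = n) :
    Odd (genusSum₁ n fun d => genusClassNumber (GenusField d)) := by
  have hn0 : 0 < n := hn ▸ Finset.prod_pos fun i _ => (hp i).pos
  have hn1 : 1 < n := by
    rw [← hn, Fin.prod_univ_succ]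
    exact lt_of_lt_of_le (hp 0).one_lt
      (Nat.le_mul_of_pos_right _ (Finset.prod_pos fun i _ => (hp i.succ).pos))
  have hp0n : p 0 ∣ n := hn ▸ Finset.dvd_prod_of_mem p (Finset.mem_univ 0)
  set F := (decompositions n).filter (fun D => (D.filter fun d => d % 8 ≠ 1).card ≤ 1) with hF
  have hmem : {n} ∈ F := by
    rw [hF, Finset.mem_filter]
    refine ⟨singleton_mem_decompositions hn1, ?_⟩
    exact (Finset.card_filter_le _ _).trans (Finset.card_singleton n).le
  unfold genusSum₁
  rw [← hF, ← Finset.add_sum_erase F _ hmem, Finset.prod_singleton]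
  refine Odd.add_even ?_ ?_
  · exact odd_genusClassNumber_caseSeven p hR hp hinj h7 h1 hG hn (GenusField n)
      (isQuadraticFieldOfSqrt_genusField hn0)
  · rw [even_iff_two_dvd]
    refine Finset.dvd_sum fun D hD => ?_
    have hDF := Finset.mem_of_mem_erase hD
    rw [hF, Finset.mem_filter] at hDF
    obtain ⟨d, hdD, hd0⟩ := exists_mem_not_dvd_of_mem_decompositions (hp 0) hp0n hDF.1
      (Finset.ne_of_mem_erase hD)
    have hD' := hDF.1
    simp only [decompositions, Finset.mem_filter, Finset.mem_powerset] at hD'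
    have hdn : d ∣ n := Nat.dvd_of_mem_divisors (hD'.1 hdD)
    have hd1 : 1 < d := hD'.2.1 d hdD
    refine dvd_trans ?_ (Finset.dvd_prod_of_mem _ hdD)
    exact even_iff_two_dvd.mp (even_genusClassNumber_of_dvd_caseSeven p hR hp hinj h1 (hn ▸ hdn) hd0 hd1
      (GenusField d) (isQuadraticFieldOfSqrt_genusField hd1.le))

/-! ## §5 Consequences on the family: Tian–Yuan–Zhang's rank-one datum (mod TYZ Thm 1.2, RR) and Tian's Thm 1.3 (mod Thm 1.3, RR) -/

/-- `2k(n) − 2 − a(n) = 2k − 1` for `n = p₀p₁⋯p_k` with distinct odd primes (`k(n) = k + 1`, `a(n) = 1`).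
[cite: TianYuanZhang2017, §1 (chunk p0002 L63–L65: k(n), a(n))] -/
theorem twoExponent_caseSeven (hp : ∀ i, (p i).Prime) (hinj : Function.Injective p) (h7 : p 0 % 8 = 7)
    (h1 : ∀ i, i ≠ 0 → p i % 8 = 1) : twoExponent (∏ i, p i) = 2 * (k : ℤ) - 1 := by
  have hodd := odd_of_caseSeven p h7 h1
  have hprod : ∏ i, p i = ∏ q ∈ univ.image p, q := by
    rw [Finset.prod_image fun i _ j _ h => hinj h]
  have hpf : (∏ i, p i).primeFactors = univ.image p := by
    rw [hprod, Nat.primeFactors_prod]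
    simpa using fun i => hp i
  have hk : oddPrimeFactorCount (∏ i, p i) = k + 1 := by
    rw [oddPrimeFactorCount, hpf, Finset.filter_true_of_mem (by simpa using fun i => hodd i),
      Finset.card_image_of_injective _ hinj, Finset.card_univ, Fintype.card_fin]
  have ha : oddIndicator (∏ i, p i) = 1 := by
    rw [oddIndicator, if_neg (Nat.not_even_iff_odd.mpr
      (Finset.prod_induction _ Odd (fun a b ha hb => ha.mul hb) odd_one fun i _ => hodd i))]
  rw [twoExponent, hk, ha]
  push_cast
  ring

/-- **The rank-one datum on Tian's class-`7` family, modulo TYZ Thm 1.2 (`h12`) and Rédei–Reichardt (`hR`).**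
For `n = p₀p₁⋯p_k` (`p₀ ≡ 7`, `pᵢ ≡ 1 (mod 8)`, distinct, `G(n)` odd): `ord_{s=1} L(E_n, s) = 1` and
`L′(E_n, 1) = 2^{2k−1} · 𝓛² · Ω(E_n) · Reg(E_n)` with `𝓛` an ODD integer — `ρ(n) = 0` (§2) and `Σ₁(n)` odd (§4)
fed into `rankOneDatum_of_index_eq_one`.  No L-value is computed; every `k`.  (Tian's Thm 1.3 prints
`ord_{s=1} L(E^{(n)}, s) = 1` on this family; here it is re-derived from Tian–Yuan–Zhang's genus-period parity.)
[cite: TianYuanZhang2017, Thm. 1.2 and §1 (1.1)] [cite: Tian2014, Thm. 1.3 (arXiv p. 2, L5–L15)] [cite: LiMa2008, Thm. 0.4] -/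
theorem rankOneDatum_caseSeven (h12 : thm12_parity_of_scriptL) (hR : redeiReichardt_fourTwoCard_classGroup)
    (hp : ∀ i, (p i).Prime) (hinj : Function.Injective p) (h7 : p 0 % 8 = 7)
    (h1 : ∀ i, i ≠ 0 → p i % 8 = 1) (hG : ∀ v, legendreMatrix p *ᵥ v = 0 → v = 0 ∨ v = fun _ => 1)
    {n : ℕ} (hn : ∏ i, p i = n) :
    ∃ L : ℤ, Odd L ∧ (congruentNumberCurve n).analyticRank = 1 ∧
      deriv (congruentNumberCurve n).entireLFunction 1 =
        (2 : ℂ) ^ (2 * (k : ℤ) - 1) * (L : ℂ) ^ 2 *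
          ((congruentNumberCurve n).realPeriodRat : ℂ) * ((congruentNumberCurve n).regulator : ℂ) := by
  have hsq : Squarefree n := hn ▸ squarefree_prod_of_injective p hp hinj
  have h8 : n % 8 = 7 := hn ▸ prod_mod_eight_caseSeven p h7 h1
  have hexp : twoExponent n = 2 * (k : ℤ) - 1 := hn ▸ twoExponent_caseSeven p hp hinj h7 h1
  obtain ⟨L, hL, hr, hd⟩ := rankOneDatum_of_index_eq_one h12 hsq (Or.inr h8)
    (rhoIndex_eq_one_caseSeven p hp hinj h7 h1 hG hn) GenusField (isGenusFieldFamily_genusField n)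
    (Or.inl (odd_genusSum₁_caseSeven p hR hp hinj h7 h1 hG hn))
  exact ⟨L, hL, hr, hexp ▸ hd⟩

/-- **Tian 2014 Thm 1.3 ON THE GRAPH-FORM FAMILY, condition (1.1) discharged** (modulo the displayed Thm 1.3
`h13` and Rédei–Reichardt `hR`): for `n = p₀p₁⋯p_k` (`p₀ ≡ 7`, `pᵢ ≡ 1 (mod 8)`, distinct, `G(n)` odd),
`rank E_n(ℚ) = 1 = ord_{s=1} L(E_n, s)` and `Ш(E_n)` is finite of odd order.  The quadratic field is
instantiated as `GenusField (2n) = ℚ[X]/(X² + 2n) ∋ √−2n` and (1.1) is `condition11_caseSeven` (§3).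
[cite: Tian2014, Thm. 1.3 with Lemma 5.1 (arXiv p. 2, L5–L15; p. 28, L2–L16)] [cite: LiMa2008, Thm. 0.4] -/
theorem thm13_caseSeven (h13 : thm13_rank_one_and_sha_odd) (hR : redeiReichardt_fourTwoCard_classGroup)
    (hp : ∀ i, (p i).Prime) (hinj : Function.Injective p) (h7 : p 0 % 8 = 7)
    (h1 : ∀ i, i ≠ 0 → p i % 8 = 1) (hG : ∀ v, legendreMatrix p *ᵥ v = 0 → v = 0 ∨ v = fun _ => 1)
    {n : ℕ} (hn : ∏ i, p i = n) :
    (congruentNumberCurve n).mordellWeilRank = 1 ∧ (congruentNumberCurve n).analyticRank = 1 ∧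
      Finite (congruentNumberCurve n).sha ∧ Odd (Nat.card (congruentNumberCurve n).sha) := by
  have hodd := odd_of_caseSeven p h7 h1
  have hp2 : ∀ i, p i ≠ 2 := fun i h => by
    have := hodd i; rw [h] at this; exact (Nat.not_odd_iff_even.mpr even_two) this
  have h8 : n % 8 = 7 := hn ▸ prod_mod_eight_caseSeven p h7 h1
  have hn0 : 0 < n := hn ▸ Finset.prod_pos fun i _ => (hp i).pos
  have hK : IsQuadraticFieldOfSqrt (GenusField (2 * n)) (-(2 * n : ℤ)) := by
    have h := isQuadraticFieldOfSqrt_genusField (d := 2 * n) (by omega)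
    have hc : (-((2 * n : ℕ) : ℤ)) = -(2 * n : ℤ) := by push_cast; ring
    rwa [hc] at h
  exact h13 k p hp hp2 hinj h1 n hn.symm (GenusField (2 * n)) hK
    (condition11_caseSeven p hR hp hinj h7 h1 hG hn _ hK) n (Or.inl rfl) (Or.inr (Or.inr h8))

/-- From Tian's Thm 1.3 on the graph-form family: `Ш(E_n)[2^∞] = 0` (`#Ш(E_n)(2) = 1`) — the ALGEBRAIC
`2`-part, modulo `h13` and `hR`. [cite: Tian2014, Thm. 1.3 and Rem. 1.4 (arXiv p. 2)] -/
theorem card_primaryComponent_sha_two_caseSeven (h13 : thm13_rank_one_and_sha_odd)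
    (hR : redeiReichardt_fourTwoCard_classGroup) (hp : ∀ i, (p i).Prime) (hinj : Function.Injective p)
    (h7 : p 0 % 8 = 7) (h1 : ∀ i, i ≠ 0 → p i % 8 = 1)
    (hG : ∀ v, legendreMatrix p *ᵥ v = 0 → v = 0 ∨ v = fun _ => 1) {n : ℕ} (hn : ∏ i, p i = n) :
    Nat.card (AddCommGroup.primaryComponent (congruentNumberCurve n).sha 2) = 1 := by
  obtain ⟨-, -, hfin, hodd⟩ := thm13_caseSeven p h13 hR hp hinj h7 h1 hG hn
  haveI := hfin
  haveI : Fact (2 : ℕ).Prime := ⟨Nat.prime_two⟩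
  rw [card_addPrimaryComponent_eq_pow, Nat.factorization_eq_zero_of_not_dvd hodd.not_two_dvd_nat,
    pow_zero]

/-! ## §6 The three door inputs in the sub-lane's TABLE currency (for `bsdp_two_congruentNumberCurve_of_genus'`) -/

/-- **`hker` in table form.**  With the literal tables `L i j := addLegendreSym (p j) (p i)`,
`d2 i := addLegendreSym 2 (p i)`, `dm2 i := addLegendreSym (−2) (p i)` (so that the door's `hL`, `h2`, `hm2`
are `fun _ _ => rfl`, `fun _ => rfl`, `fun _ => rfl`), the door's block matrix is `monskyMatrixOdd p` and its
kernel count is `2` on Tian's class-`7` family. [cite: HeathBrown1994SelmerCongruentII, Appendix (Monsky), typescript p. 39 L27–L33]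
[cite: Tian2014, (5.1) (arXiv p. 29)] -/
theorem card_ker_monskyTable_caseSeven (h7 : p 0 % 8 = 7) (h1 : ∀ i, i ≠ 0 → p i % 8 = 1)
    (hG : ∀ v, legendreMatrix p *ᵥ v = 0 → v = 0 ∨ v = fun _ => 1) :
    Fintype.card {v : Fin (k + 1) ⊕ Fin (k + 1) → ZMod 2 // Matrix.fromBlocks
        (Matrix.of (fun i j => if i = j then ∑ l ∈ Finset.univ.erase i, addLegendreSym (p l) (p i)
            else addLegendreSym (p j) (p i)) + Matrix.diagonal (fun i => addLegendreSym 2 (p i)))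
        (Matrix.diagonal fun i => addLegendreSym 2 (p i)) (Matrix.diagonal fun i => addLegendreSym 2 (p i))
        (Matrix.of (fun i j => if i = j then ∑ l ∈ Finset.univ.erase i, addLegendreSym (p l) (p i)
            else addLegendreSym (p j) (p i)) + Matrix.diagonal (fun i => addLegendreSym (-2) (p i)))
        *ᵥ v = 0} = 2 :=
  card_ker_monskyMatrixOdd_caseSeven p h7 h1 hG

/-! ## §7 ERRATUM F-Σ2 (2026-08-22): the rank-one datum keyed to TYZ Thm 1.2 AS PRINTED (`thm12_parity_of_scriptL'`)

The displayed fact `thm12_parity_of_scriptL` used by `rankOneDatum_caseSeven` (§5) is MIS-STATED in its `Σ₂`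
clauses (ERRATUM in `TianYuanZhang2017/GenusPeriodsParity.lean`).  This family feeds `Σ₁` only
(`odd_genusSum₁_caseSeven`, §4), so the conclusion is unchanged; the primed theorem below re-derives it from the
corrected fact `thm12_parity_of_scriptL'` via `rankOneDatum_of_index_eq_one'`.  Consumers should migrate to it. -/

/-- **The rank-one datum on Tian's class-`7` family, modulo TYZ Thm 1.2 AS PRINTED (`h12 : thm12_parity_of_scriptL'`)
and Rédei–Reichardt (`hR`).**  For `n = p₀p₁⋯p_k` (`p₀ ≡ 7`, `pᵢ ≡ 1 (mod 8)`, distinct, `G(n)` odd):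
`ord_{s=1} L(E_n, s) = 1` and `L′(E_n, 1) = 2^{2k−1} · 𝓛² · Ω(E_n) · Reg(E_n)` with `𝓛` odd — `ρ(n) = 0` (§2) and
`Σ₁(n)` odd (§4) fed into `rankOneDatum_of_index_eq_one'`.
[cite: TianYuanZhang2017, Thm. 1.2 and §1 (1.1)] [cite: Tian2014, Thm. 1.3 (arXiv p. 2, L5–L15)] [cite: LiMa2008, Thm. 0.4] -/
theorem rankOneDatum_caseSeven' (h12 : thm12_parity_of_scriptL') (hR : redeiReichardt_fourTwoCard_classGroup)
    (hp : ∀ i, (p i).Prime) (hinj : Function.Injective p) (h7 : p 0 % 8 = 7)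
    (h1 : ∀ i, i ≠ 0 → p i % 8 = 1) (hG : ∀ v, legendreMatrix p *ᵥ v = 0 → v = 0 ∨ v = fun _ => 1)
    {n : ℕ} (hn : ∏ i, p i = n) :
    ∃ L : ℤ, Odd L ∧ (congruentNumberCurve n).analyticRank = 1 ∧
      deriv (congruentNumberCurve n).entireLFunction 1 =
        (2 : ℂ) ^ (2 * (k : ℤ) - 1) * (L : ℂ) ^ 2 *
          ((congruentNumberCurve n).realPeriodRat : ℂ) * ((congruentNumberCurve n).regulator : ℂ) := by
  have hsq : Squarefree n := hn ▸ squarefree_prod_of_injective p hp hinj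
  have h8 : n % 8 = 7 := hn ▸ prod_mod_eight_caseSeven p h7 h1
  have hexp : twoExponent n = 2 * (k : ℤ) - 1 := hn ▸ twoExponent_caseSeven p hp hinj h7 h1
  obtain ⟨L, hL, hr, hd⟩ := rankOneDatum_of_index_eq_one' h12 hsq (Or.inr h8)
    (rhoIndex_eq_one_caseSeven p hp hinj h7 h1 hG hn) GenusField (isGenusFieldFamily_genusField n)
    (Or.inl (odd_genusSum₁_caseSeven p hR hp hinj h7 h1 hG hn))
  exact ⟨L, hL, hr, hexp ▸ hd⟩

/-- Parity bookkeeping for the corrected second genus sum on this family: since `n = ∏ pᵢ ≡ 7 (mod 8)` and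
`n > 1`, `Σ₂'(n) = Σ₂(n) + g(n)` (`TianYuanZhang2017.genusSum₂'_eq_genusSum₂_add_self`), whence
`Σ₂'` is odd iff exactly one of `Σ₂(n)`, `g(n)` is.  (No claim about which branch holds is made; the family's
door input is `Σ₁`, §4.) [cite: TianYuanZhang2017, Thm. 1.2 (Σ₂ as printed, incl. the term ℓ = 0)] -/
theorem odd_genusSum₂'_iff_caseSeven (h7 : p 0 % 8 = 7) (h1 : ∀ i, i ≠ 0 → p i % 8 = 1) {n : ℕ}
    (hn : ∏ i, p i = n) (g : ℕ → ℕ) :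
    Odd (genusSum₂' n g) ↔ (Odd (genusSum₂ n g) ↔ Even (g n)) := by
  have h8 : n % 8 = 7 := hn ▸ prod_mod_eight_caseSeven p h7 h1
  exact odd_genusSum₂'_iff (by omega) (Or.inr (Or.inr h8)) g

end Literature.NumberTheory.EllipticCurves.Tian2014

end
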